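import Mathlib.AlgebraicGeometry.Morphisms.FiniteType
import Mathlib.AlgebraicGeometry.Morphisms.QuasiCompact
import Mathlib.AlgebraicGeometry.Noetherian
import Mathlib.Topology.NoetherianSpace
import Mathlib.Topology.Sober
import HarnessLib

/-!
# A closed set of closed points of a finite-type scheme over a field is finite

Support file for crux stmt-ResolutionOfSingularities-15315
(`FrobeniusLadder.FInjectiveMacaulayfication`, line `isolation`, seat c6): stub
`stub_closedPointsOfClosedFinite`.

The isolation split of the F-injective Macaulayfication line needs: on a quasi-compact scheme
`X₂` locally of finite type over a field `k`, a CLOSED subset `Z` all of whose points are closed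
points of `X₂` is FINITE (so that the bad locus, once shown closed and made of closed points, is a
finite set of centres to be blown up one at a time).

Proof: `X₂` is locally Noetherian (`LocallyOfFiniteType.isLocallyNoetherian`, the base `Spec k`
being Noetherian) and compact (`QuasiCompact.compactSpace_of_compactSpace`, the base being
compact), hence a Noetherian scheme, whose underlying space is a Noetherian topological space
(`IsNoetherian.noetherianSpace`); schemes are quasi-sober. In a Noetherian quasi-sober space a
closed set `Z` is a finite union of irreducible closed subsets
(`NoetherianSpace.exists_finite_set_isClosed_irreducible`), each of which has a generic point
`η ∈ Z`; as `{η}` is closed, that component is `closure {η} = {η}`, so `Z` is a finite union of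
singletons. (Quasi-soberness is needed: an infinite cofinite space is Noetherian and `T₁`.)

References: folklore bookkeeping over Mathlib's `NoetherianSpace` / `QuasiSober` /
`IsNoetherian` API; no definition is declared. [folklore]
-/

-- single-problem summit: the doubled namespace component `ResolutionOfSingularities` is forced
set_option linter.dupNamespace false

noncomputable section

namespace Summit.ResolutionOfSingularities.ResolutionOfSingularities.Theorems.FInjectiveMacaulayfication.ClosedPointsOfClosedFinite

open AlgebraicGeometry CategoryTheory TopologicalSpace

/-- In a Noetherian quasi-sober topological space, a closed subset all of whose points are closed
points is finite: it is a finite union of irreducible closed subsets, each the closure of a generic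
point, i.e. a singleton. [folklore] -/
theorem finite_of_isClosed_of_forall_isClosed_singleton {X : Type*} [TopologicalSpace X]
    [NoetherianSpace X] [QuasiSober X] {Z : Set X} (hZ : IsClosed Z)
    (h : ∀ x ∈ Z, IsClosed ({x} : Set X)) : Z.Finite := by
  obtain ⟨S, hSf, hSc, hSi, rfl⟩ := NoetherianSpace.exists_finite_set_isClosed_irreducible hZ
  refine hSf.sUnion fun t ht => ?_
  obtain ⟨x, hx⟩ := QuasiSober.sober (hSi t ht) (hSc t ht)
  have ht' : t = {x} := by
    rw [← hx.def, (h x (Set.subset_sUnion_of_mem ht hx.mem)).closure_eq]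
  rw [ht']
  exact Set.finite_singleton x

/-- A quasi-compact scheme locally of finite type over a field is a Noetherian scheme; in
particular its underlying topological space is Noetherian. [folklore] -/
theorem isNoetherian_of_locallyOfFiniteType_of_quasiCompact {k : Type} [Field k] {X : Scheme.{0}}
    (f : X ⟶ Spec (.of k)) [LocallyOfFiniteType f] [QuasiCompact f] : IsNoetherian X :=
  haveI : IsLocallyNoetherian X := LocallyOfFiniteType.isLocallyNoetherian f
  haveI : CompactSpace X := QuasiCompact.compactSpace_of_compactSpace f
  {}

/-- **A closed set of closed points of a quasi-compact scheme locally of finite type over a field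
is finite.** For a field `k`, a scheme `X₂` with structure morphism `f₂ : X₂ ⟶ Spec k` locally of
finite type and quasi-compact, and a closed subset `Z ⊆ X₂` every point of which is a closed point
of `X₂`, the set `Z` is finite: `X₂` is a Noetherian scheme, so its underlying space is Noetherian
and (as every scheme) quasi-sober, and there a closed set of closed points is a finite union of
one-point irreducible components. [folklore] -/
theorem stub_closedPointsOfClosedFinite : ∀ (k : Type) [Field k] (X₂ : Scheme.{0}) (f₂ : X₂ ⟶ Spec (.of k)),
    LocallyOfFiniteType f₂ → QuasiCompact f₂ → ∀ Z : Set X₂, IsClosed Z →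
      (∀ x ∈ Z, IsClosed ({x} : Set X₂)) → Z.Finite := by
  intro k _ X₂ f₂ _ _ Z hZ h
  haveI : IsNoetherian X₂ := isNoetherian_of_locallyOfFiniteType_of_quasiCompact f₂
  exact finite_of_isClosed_of_forall_isClosed_singleton hZ h

end Summit.ResolutionOfSingularities.ResolutionOfSingularities.Theorems.FInjectiveMacaulayfication.ClosedPointsOfClosedFinite

end
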